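import Literature.Computability.Cryptography.UnitResidueAlgorithm
import HarnessLib

/-!
# The unit-residue algorithm, VI: the algorithm and its correctness

Topic `Computability/Cryptography`, the summit of `UnitResidue*.lean`: the abstract (exact-integer)
algorithm `algo d r m N` behind `JacobsonWilliams2008_unitResidue_mem_FP` and its correctness
**`algo_eq`**: for squarefree `d ≥ 2`, `m ≥ 1`, the least unit pair `(a, b)` of `ℚ(√d)` (fundamental
unit `ε₀ = (a + b√d)/2`), an integer `r` within `1` of `ln ε₀`, and any fuel `64n ≤ N ≤ 128n`
(`n = size d + size r + size m + 4`), `algo d r m N = (a mod m, b mod m)`.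

The algorithm (Jacobson–Williams, *Solving the Pell Equation*, §12.2 Alg. 12.6 CR and §12.3, in the
division-free coordinate form of this series): convert `r` to binary-log units `r₂`; if `r₂ ≤ 16n`
walk the principal cycle from `(1)` by baby steps to the first ideal of norm `1` (that is `(ε₀)`);
otherwise climb the binary ladder of levels (`UnitResidueLevels.lean`) to distance `≈ r₂ - 4n` just
below `log₂ ε₀` and finish by baby steps; read `(a, b) mod m` off the coordinates of `±ε₀` with the
recorded sign. The register machine computing `algo` with `p, r` reduced modulo `m` is
`UnitResidueMachine.lean`.

Everything is proved; no named facts.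

## References

* M. J. Jacobson, Jr., H. C. Williams, *Solving the Pell Equation*, CMS Books in Mathematics, Springer
  (2009), §12.2 (Alg. 12.6 CR), §12.3, §7.4. [JacobsonWilliams2008]
-/

noncomputable section

open scoped Classical

namespace Literature.Computability.Cryptography.UnitResidue

open Literature.NumberTheory.QuadraticFields.Infra

/-! ### The algorithm -/

/-- The size parameter `n = size d + size r + size m + 4`. [folklore] -/
def nOf (d r m : ℕ) : ℕ := Nat.size d + Nat.size r + Nat.size m + 4

/-- The static data of a run: `Δ = disc d`, `P = 3n + 16`, `q = 4n + 22`, `Sq = ⌊2^q √Δ⌋`.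
[cite: JacobsonWilliams2008, §12.2 (precision of CR)] -/
def pmOf (d r m : ℕ) : Prm :=
  ⟨disc d, 3 * nOf d r m + 16, 4 * nOf d r m + 22, Nat.sqrt (disc d * 4 ^ (4 * nOf d r m + 22))⟩

/-- The ladder parameters of a run with target `T`. [cite: JacobsonWilliams2008, §12.2] -/
def lpOf (d r m N : ℕ) (T : ℤ) : LP :=
  ⟨pmOf d r m, N, 2 * nOf d r m + 8, T, Nat.size T.toNat - 1, nOf d r m⟩

/-- **The unit-residue algorithm** (abstract, exact coordinates).
[cite: JacobsonWilliams2008, §12.2 Alg. 12.6 (CR), §12.3] -/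
def algo (d r m N : ℕ) : ℕ × ℕ :=
  let n := nOf d r m
  let pm := pmOf d r m
  let r₂ := r2 r (2 * n + 12)
  if r₂ ≤ 16 * n then
    out d m (finWalk pm.Δ N (fstepAS pm.Δ (s0 pm)))
  else
    let T := r₂ - 4 * n
    let lp := lpOf d r m N T
    let k₀ := kz T lp.l (lp.c₀ + 1) N
    out d m (finWalk pm.Δ N (levels lp k₀ (lp.l - k₀) (gwalk pm (pref T lp.l k₀ - lp.c₀) N (s0 pm))))

/-! ### Validity of the parameters -/

variable {d r m : ℕ}

/-- `size (disc d) ≤ size d + 2 ≤ n - 2`. [folklore] -/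
theorem size_disc_le (d r m : ℕ) : Nat.size (disc d) + 2 ≤ nOf d r m := by
  unfold nOf disc
  have : Nat.size (4 * d) ≤ Nat.size d + 2 := by
    rw [Nat.size_le, pow_add]
    have := Nat.lt_size_self d
    nlinarith
  split_ifs <;> omega

/-- The static data of a run are valid. [folklore] -/
theorem pmOf_OK (hd : Squarefree d) (h2 : 2 ≤ d) : (pmOf d r m).OK where
  disc := disc_isDisc hd h2
  fund := disc_isFundDisc hd h2
  sq_def := rfl
  q_large := by have := size_disc_le d r m; simp only [pmOf]; omega
  P_large := by have := size_disc_le d r m; simp only [pmOf]; omega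
  five_le := five_le_disc h2

/-- `Δ < 2^n` and `log₂ √Δ < n`. [folklore] -/
theorem disc_lt_two_pow (d r m : ℕ) : disc d < 2 ^ nOf d r m ∧ Real.logb 2 (rt (disc d)) < nOf d r m := by
  have h1 : disc d < 2 ^ Nat.size (disc d) := Nat.lt_size_self _
  have h2 := size_disc_le d r m
  have h3 : 2 ^ Nat.size (disc d) ≤ 2 ^ nOf d r m := Nat.pow_le_pow_right (by norm_num) (by omega)
  refine ⟨lt_of_lt_of_le h1 h3, ?_⟩
  have hΔ : (disc d : ℝ) < (2 : ℝ) ^ nOf d r m := by exact_mod_cast lt_of_lt_of_le h1 h3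
  by_cases h0 : disc d = 0
  · rw [h0]; unfold rt; simp; exact_mod_cast (show 0 < nOf d r m by unfold nOf; omega)
  · have hpos : (0 : ℝ) < rt (disc d) := by
      unfold rt; apply Real.sqrt_pos.mpr; exact_mod_cast Nat.pos_of_ne_zero h0
    have hsq := rt_sq (disc d)
    have hlt : rt (disc d) < (2 : ℝ) ^ nOf d r m := by
      have : (1 : ℝ) ≤ (2 : ℝ) ^ nOf d r m := one_le_pow₀ (by norm_num)
      nlinarith
    calc Real.logb 2 (rt (disc d)) < Real.logb 2 ((2 : ℝ) ^ nOf d r m) := Real.logb_lt_logb (by norm_num) hpos hlt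
      _ = nOf d r m := by rw [Real.logb_pow, Real.logb_self_eq_one (by norm_num)]; simp

/-! ### The two finishing scenarios -/

variable {pm : Prm}

/-- `walk (ρ F) j = walk F (j+1)`. [folklore] -/
theorem walk_bstep (Δ : ℕ) (F : St) (j : ℕ) : walk Δ (bstep Δ F) j = walk Δ F (j + 1) :=
  (Function.iterate_succ_apply (bstep Δ) j F).symm

/-- **Small regulator**: walking from `(1)` (after one forced step) to the first ideal of norm `1`
reaches `ε₀` itself with sign `+`, within `2k` rounds if `ε₀ ≤ 2^k`.
[cite: JacobsonWilliams2008, §7.4 (R_Δ by walking the principal cycle)] -/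
theorem small_case (hpm : pm.OK) {u₀ : ℤ × ℤ} (hu : IsUnitO pm.Δ u₀) (hε1 : 1 < ev pm.Δ (rt pm.Δ) u₀)
    (hleast : ∀ p, IsUnitO pm.Δ p → 1 < |ev pm.Δ (rt pm.Δ) p| → ev pm.Δ (rt pm.Δ) u₀ ≤ |ev pm.Δ (rt pm.Δ) p|)
    {k N : ℕ} (hk : ev pm.Δ (rt pm.Δ) u₀ ≤ (2 : ℝ) ^ k) (hN : 2 * k ≤ N) :
    (finWalk pm.Δ N (fstepAS pm.Δ (s0 pm))).fr.p = u₀ ∧ (finWalk pm.Δ N (fstepAS pm.Δ (s0 pm))).sgn = 1 := by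
  obtain ⟨hg, hev⟩ := good_s0 hpm
  have hI := hg.inv
  have hR := hg.red
  have hθ0 : theta pm.Δ (s0 pm).fr 0 = 1 := by unfold theta; rw [walk_zero, hev, abs_one]
  have habs : |ev pm.Δ (rt pm.Δ) u₀| = ev pm.Δ (rt pm.Δ) u₀ := abs_of_pos (by linarith)
  obtain ⟨N₁, hN1, ha1, hbef, hsign, hbound⟩ := hI.first_unit hpm.disc hR hu
    (by rw [hθ0, habs]; exact hε1)
    (fun u' hu' h1 => by rw [habs]; rw [hθ0] at h1; exact hleast u' hu' h1)
  have hN1le : N₁ ≤ 2 * k := hbound k (by rw [hθ0, habs, mul_one]; exact hk)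
  -- the final walk from the state after one forced step
  have hfr : (fstepAS pm.Δ (s0 pm)).fr = bstep pm.Δ (s0 pm).fr := rfl
  obtain ⟨hfr', hsgn'⟩ := finWalk_eq (Δ := pm.Δ) (s := fstepAS pm.Δ (s0 pm)) (N₁ := N₁ - 1)
    (by rw [hfr, walk_bstep, Nat.sub_add_cancel hN1]; exact ha1)
    (fun i hi => by rw [hfr, walk_bstep]; exact hbef (i + 1) (by omega) (by omega)) (n := N) (by omega)
  rw [hfr, walk_bstep, Nat.sub_add_cancel hN1] at hfr'
  -- positivity of `θ` along the walk forces `+ε₀`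
  have hpos := (hg.bstepF_iterate hpm N₁).pos
  rw [bstepF_iterate_fr, bstepF_iterate_sgn] at hpos
  change (0:ℝ) < ((1 : ℤ) : ℝ) * _ at hpos
  rw [Int.cast_one, one_mul] at hpos
  refine ⟨?_, by rw [hsgn']; rfl⟩
  rw [hfr']
  rcases hsign with h | h
  · exact ev_injective (irrational_rt hpm.disc) h
  · exfalso; rw [h] at hpos; linarith

/-- **Large regulator, finish**: from a good state with `1 < |θ| < ε₀` the final walk reaches `±ε₀`
with the matching sign, within `2k` rounds if `ε₀ ≤ 2^k |θ|`. [cite: JacobsonWilliams2008, §7.4, §12.3] -/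
theorem large_final (hpm : pm.OK) {u₀ : ℤ × ℤ} (hu : IsUnitO pm.Δ u₀) (hε0 : 0 < ev pm.Δ (rt pm.Δ) u₀)
    (hleast : ∀ p, IsUnitO pm.Δ p → 1 < |ev pm.Δ (rt pm.Δ) p| → ev pm.Δ (rt pm.Δ) u₀ ≤ |ev pm.Δ (rt pm.Δ) p|)
    {s : AS} {ε : ℝ} (hg : Good pm s ε) (h1 : 1 < |ev pm.Δ (rt pm.Δ) s.fr.p|)
    (hlt : |ev pm.Δ (rt pm.Δ) s.fr.p| < ev pm.Δ (rt pm.Δ) u₀)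
    {k N : ℕ} (hk : ev pm.Δ (rt pm.Δ) u₀ ≤ (2 : ℝ) ^ k * |ev pm.Δ (rt pm.Δ) s.fr.p|) (hN : 2 * k ≤ N) :
    ((finWalk pm.Δ N s).fr.p = u₀ ∧ (finWalk pm.Δ N s).sgn = 1) ∨
      ((finWalk pm.Δ N s).fr.p = (-u₀.1, -u₀.2) ∧ (finWalk pm.Δ N s).sgn = -1) := by
  have hI := hg.inv
  have hR := hg.red
  have habs : |ev pm.Δ (rt pm.Δ) u₀| = ev pm.Δ (rt pm.Δ) u₀ := abs_of_pos hε0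
  have hθ0 : theta pm.Δ s.fr 0 = |ev pm.Δ (rt pm.Δ) s.fr.p| := rfl
  obtain ⟨N₁, hN1, ha1, hbef, hsign, hbound⟩ := hI.first_unit hpm.disc hR hu
    (by rw [hθ0, habs]; exact hlt)
    (fun u' hu' h1' => by rw [habs]; rw [hθ0] at h1'; exact hleast u' hu' (h1.trans h1'))
  have hN1le : N₁ ≤ 2 * k := hbound k (by rw [hθ0, habs]; exact hk)
  -- `a ≠ 1` at the start: `θ` is not a unit
  have ha0 : s.fr.a ≠ 1 := by
    intro ha
    have hunit := hI.isUnitO_of_a_eq_one hpm.disc ha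
    have := hleast s.fr.p hunit h1
    linarith
  obtain ⟨hfr', hsgn'⟩ := finWalk_eq (Δ := pm.Δ) (s := s) (N₁ := N₁) ha1
    (fun i hi => by
      rcases Nat.eq_zero_or_pos i with hi0 | hip
      · subst hi0; exact ha0
      · exact hbef i hip hi) (n := N) (by omega)
  have hpos := (hg.bstepF_iterate hpm N₁).pos
  rw [bstepF_iterate_fr, bstepF_iterate_sgn] at hpos
  rw [hfr', hsgn']
  rcases hsign with h | h
  · left
    refine ⟨ev_injective (irrational_rt hpm.disc) h, ?_⟩
    rw [h] at hpos
    rcases hg.sgn with hs | hs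
    · exact hs
    · exfalso; rw [hs] at hpos; push_cast at hpos; linarith
  · right
    refine ⟨ev_injective (irrational_rt hpm.disc) (by rw [ev_neg]; exact h), ?_⟩
    rw [h] at hpos
    rcases hg.sgn with hs | hs
    · exfalso; rw [hs] at hpos; push_cast at hpos; linarith
    · exact hs

/-! ### Parameters of the large case -/

/-- The ladder parameters of a run are valid for `T ≥ 1` and `N ≥ 64n`. [folklore] -/
theorem lpOf_OK (hd : Squarefree d) (h2 : 2 ≤ d) {N : ℕ} {T : ℤ} (hT : 1 ≤ T) (hN : 64 * nOf d r m ≤ N) :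
    (lpOf d r m N T).OK := by
  have hn4 : 4 ≤ nOf d r m := by unfold nOf; omega
  obtain ⟨hΔ, hrt⟩ := disc_lt_two_pow d r m
  have hTn : 1 ≤ T.toNat := by omega
  have hsz : 1 ≤ Nat.size T.toNat := Nat.size_pos.mpr (by omega)
  have hlo : 2 ^ (Nat.size T.toNat - 1) ≤ T.toNat := Nat.lt_size.mp (by omega)
  have hhi : T.toNat < 2 ^ Nat.size T.toNat := Nat.lt_size_self _
  refine ⟨pmOf_OK hd h2, hT, ?_, hrt, hΔ, by simp [lpOf], by simp [lpOf]; omega, by simp [lpOf]; omega,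
    by simp [lpOf]; omega⟩
  simp only [lpOf]
  have e : ((T.toNat : ℕ) : ℤ) = T := Int.toNat_of_nonneg (by omega)
  constructor
  · have : ((2 ^ (Nat.size T.toNat - 1) : ℕ) : ℤ) ≤ (T.toNat : ℤ) := by exact_mod_cast hlo
    rw [e] at this; exact_mod_cast this
  · have : (T.toNat : ℤ) < ((2 ^ Nat.size T.toNat : ℕ) : ℤ) := by exact_mod_cast hhi
    rw [e, show Nat.size T.toNat = Nat.size T.toNat - 1 + 1 by omega] at this
    exact_mod_cast this

/-- **The accuracy budget**: `2^{l+1} (5N + 6 + 10N)/2^{3n+16} ≤ 1/8` for `N ≤ 128n`, `l ≤ n + 2`.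
[folklore] -/
theorem budget_ok {n N l : ℕ} (hn : 1 ≤ n) (hN : N ≤ 128 * n) (hl : l ≤ n + 2) :
    (2 : ℝ) ^ (l + 1) * ((N : ℝ) * (5 / (2 : ℝ) ^ (3 * n + 16)) + (6 + 10 * (N : ℝ)) / (2 : ℝ) ^ (3 * n + 16)) ≤ 1 / 8 := by
  have hnat : 8 * 2 ^ (l + 1) * (15 * N + 6) ≤ 2 ^ (3 * n + 16) := by
    have h1 : 2 ^ (l + 1) ≤ 2 ^ (n + 3) := Nat.pow_le_pow_right (by norm_num) (by omega)
    have h2 : 15 * N + 6 ≤ 2 ^ 11 * n := by omega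
    have h3 : n ≤ 2 ^ n := Nat.lt_two_pow_self.le
    calc 8 * 2 ^ (l + 1) * (15 * N + 6) ≤ 8 * 2 ^ (n + 3) * (2 ^ 11 * n) := by gcongr
      _ = 2 ^ (n + 17) * n := by rw [show n + 17 = 3 + (n + 3) + 11 by ring, pow_add, pow_add]; ring
      _ ≤ 2 ^ (n + 17) * 2 ^ n := by gcongr
      _ = 2 ^ (2 * n + 17) := by rw [← pow_add]; ring_nf
      _ ≤ 2 ^ (3 * n + 16) := Nat.pow_le_pow_right (by norm_num) (by omega)
  have hR : (8 : ℝ) * 2 ^ (l + 1) * (15 * N + 6) ≤ (2 : ℝ) ^ (3 * n + 16) := by exact_mod_cast hnat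
  have hP : (0 : ℝ) < (2 : ℝ) ^ (3 * n + 16) := by positivity
  rw [show (2 : ℝ) ^ (l + 1) * ((N : ℝ) * (5 / (2 : ℝ) ^ (3 * n + 16)) + (6 + 10 * (N : ℝ)) / (2 : ℝ) ^ (3 * n + 16))
      = (2 : ℝ) ^ (l + 1) * (15 * N + 6) / (2 : ℝ) ^ (3 * n + 16) by field_simp; ring]
  rw [div_le_iff₀ hP]
  linarith

/-! ### Correctness -/

/-- **Correctness of the unit-residue algorithm.** For squarefree `d ≥ 2`, the least unit pair
`(a, b)` (`b > 0`, `a² - db² = ±4`, `a` least), `r` within `1` of `ln ((a + b√d)/2)`, and fuel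
`64n ≤ N ≤ 128n`, the algorithm outputs `(a mod m, b mod m)`.
[cite: JacobsonWilliams2008, §12.2 Alg. 12.6 (CR), §12.3 (x, y (mod m)), §7.4] -/
theorem algo_eq {a b N : ℕ} (hd : Squarefree d) (h2 : 2 ≤ d) (hb : 0 < b) (hab : IsUnitPair d a b)
    (hmin : ∀ a' b' : ℕ, 0 < b' → IsUnitPair d a' b' → a ≤ a')
    (hr : |Real.log (((a : ℝ) + b * Real.sqrt d) / 2) - r| < 1)
    (hN : 64 * nOf d r m ≤ N) (hN' : N ≤ 128 * nOf d r m) :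
    algo d r m N = (a % m, b % m) := by
  set n := nOf d r m with hn
  have hn4 : 4 ≤ n := by rw [hn]; unfold nOf; omega
  set pm := pmOf d r m with hpmdef
  have hpm : pm.OK := pmOf_OK hd h2
  have hΔ : pm.Δ = disc d := rfl
  -- the fundamental unit in coordinates
  obtain ⟨u₀, hX, hY, hu⟩ := unit_of_pair hd h2 hab
  have hevu : ev (disc d) (rt (disc d)) u₀ = ((a : ℝ) + b * Real.sqrt d) / 2 := by
    rw [ev_eq_pair, hX, hY]; push_cast; ring
  have hε1 : 1 < ev (disc d) (rt (disc d)) u₀ := by rw [hevu]; exact one_lt_eps hd h2 hb hab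
  have hε0 : 0 < ev (disc d) (rt (disc d)) u₀ := by linarith
  have hleast : ∀ p, IsUnitO (disc d) p → 1 < |ev (disc d) (rt (disc d)) p| →
      ev (disc d) (rt (disc d)) u₀ ≤ |ev (disc d) (rt (disc d)) p| :=
    fun p hp h1 => least_abs hd h2 hab hmin hX hY hp h1
  -- the target
  have hrn : r < 2 ^ n := by
    have := Nat.lt_size_self r
    exact lt_of_lt_of_le this (Nat.pow_le_pow_right (by norm_num) (by rw [hn]; unfold nOf; omega))
  have hr2 := abs_r2_sub_logb_le (n := n) hrn (x := ev (disc d) (rt (disc d)) u₀)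
    (by rw [hevu, abs_sub_comm]; exact hr)
  rw [abs_le] at hr2
  set L := Real.logb 2 (ev (disc d) (rt (disc d)) u₀) with hL
  have hL0 : 0 < L := Real.logb_pos (by norm_num) hε1
  -- `log₂ ε₀ < 2^{n+1}`
  have hLhi : L < (2 : ℝ) ^ (n + 1) := by
    have hl2 := Real.log_two_gt_d9
    have hln : Real.log (ev (disc d) (rt (disc d)) u₀) < (2 : ℝ) ^ n := by
      have h1 : ((r : ℝ)) + 1 ≤ (2 : ℝ) ^ n := by exact_mod_cast (show r + 1 ≤ 2 ^ n by omega)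
      rw [hevu]
      rw [abs_lt] at hr
      linarith [hr.1, hr.2]
    rw [hL]; unfold Real.logb
    rw [div_lt_iff₀ (by linarith), pow_succ]
    nlinarith [pow_pos (show (0:ℝ) < 2 by norm_num) n]
  have h2N : ((2 * n + 12 : ℕ)) = 2 * n + 12 := rfl
  unfold algo
  simp only [← hn, ← hpmdef]
  split_ifs with hsmall
  · -- small regulator: `ε₀ ≤ 2^{16n+3}`
    have hsmallR : ((r2 r (2 * n + 12) : ℤ) : ℝ) ≤ 16 * n := by exact_mod_cast hsmall
    have hlog : Real.logb 2 (ev (disc d) (rt (disc d)) u₀) ≤ ((16 * n + 3 : ℕ) : ℝ) := by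
      push_cast; linarith [hr2.1]
    have hk : ev pm.Δ (rt pm.Δ) u₀ ≤ (2 : ℝ) ^ (16 * n + 3) := by
      have := (Real.logb_le_iff_le_rpow (by norm_num) hε0).mp hlog
      rwa [Real.rpow_natCast] at this
    obtain ⟨hp, hs⟩ := small_case hpm hu hε1 hleast hk (N := N) (by omega)
    exact out_eq hX hY (Or.inl ⟨hp, hs⟩)
  · -- large regulator
    push Not at hsmall
    set T : ℤ := r2 r (2 * n + 12) - 4 * n with hT
    have hT1 : 1 ≤ T := by
      have : (16 : ℤ) * n < r2 r (2 * n + 12) := by exact_mod_cast hsmall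
      omega
    set lp := lpOf d r m N T with hlpdef
    have hlp : lp.OK := lpOf_OK hd h2 hT1 hN
    have hTR : (T : ℝ) = r2 r (2 * n + 12) - 4 * n := by rw [hT]; push_cast; ring
    have hsmallR : (16 : ℝ) * n < r2 r (2 * n + 12) := by exact_mod_cast hsmall
    -- `T < 2^{n+3}`, so `l ≤ n + 2`
    have hThi : T < 2 ^ (n + 3) := by
      have h4 : (2 : ℝ) ^ (n + 3) = 2 ^ (n + 1) * 4 := by ring
      have h1 : (1 : ℝ) ≤ 2 ^ (n + 1) := one_le_pow₀ (by norm_num)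
      have hn0 : (0 : ℝ) ≤ n := by positivity
      have : (T : ℝ) < (2 : ℝ) ^ (n + 3) := by rw [hTR, h4]; linarith [hr2.2]
      exact_mod_cast this
    have hl : lp.l ≤ n + 2 := by
      show Nat.size T.toNat - 1 ≤ n + 2
      have : T.toNat < 2 ^ (n + 3) := by
        have e : ((T.toNat : ℕ) : ℤ) = T := Int.toNat_of_nonneg (by omega)
        have : ((T.toNat : ℕ) : ℤ) < ((2 ^ (n + 3) : ℕ) : ℤ) := by rw [e]; exact_mod_cast hThi
        exact_mod_cast this
      have := Nat.size_le.mpr this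
      omega
    -- the first useful level
    have hc₀ : lp.c₀ = 2 * n + 8 := rfl
    have hlT : lp.T = T := rfl
    have hp0 : pref T lp.l 0 = 1 := pref_zero hlp.l_def.1 hlp.l_def.2
    obtain ⟨hk1, hkl, hkV, hkV'⟩ := kz_spec (T := T) (l := lp.l) (V := (lp.c₀ : ℤ) + 1) (N := N)
      (by omega) (by rw [hp0, hc₀]; push_cast; omega)
      (by rw [pref_self, hc₀]; push_cast; omega) (by omega)
    set k₀ := kz T lp.l ((lp.c₀ : ℤ) + 1) N with hk₀def
    -- budgets
    have eC : lp.C = (6 + 10 * (N : ℝ)) / (2 : ℝ) ^ (3 * n + 16) := rfl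
    have eP : lp.pm.P = 3 * n + 16 := rfl
    have eN : lp.N = N := rfl
    have hbL : (2 : ℝ) ^ (lp.l + 1) * ((lp.N : ℝ) * (5 / (2 : ℝ) ^ lp.pm.P) + lp.C) ≤ 1 / 8 := by
      rw [eC, eP, eN]
      exact budget_ok (by omega) hN' hl
    have hC0 : (0 : ℝ) ≤ lp.C := by rw [eC]; positivity
    have hA0 : (0 : ℝ) ≤ (lp.N : ℝ) * (5 / (2 : ℝ) ^ lp.pm.P) := by positivity
    have hbA : (lp.N : ℝ) * (5 / (2 : ℝ) ^ lp.pm.P) ≤ 1 / 8 := by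
      have h1 : (1 : ℝ) ≤ (2 : ℝ) ^ (lp.l + 1) := one_le_pow₀ (by norm_num)
      calc (lp.N : ℝ) * (5 / (2 : ℝ) ^ lp.pm.P)
          ≤ (lp.N : ℝ) * (5 / (2 : ℝ) ^ lp.pm.P) + lp.C := le_add_of_nonneg_right hC0
        _ ≤ (2 : ℝ) ^ (lp.l + 1) * ((lp.N : ℝ) * (5 / (2 : ℝ) ^ lp.pm.P) + lp.C) :=
            le_mul_of_one_le_left (by positivity) h1
        _ ≤ 1 / 8 := hbL
    -- phase A and the levels
    have hkV2 : (lp.c₀ : ℤ) + 1 ≤ pref lp.T lp.l k₀ := by rw [hlT]; exact hkV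
    have hkV2' : pref lp.T lp.l k₀ ≤ 2 * lp.c₀ + 1 := by rw [hlT]; omega
    obtain ⟨hLA, _⟩ := LInv_phaseA hlp hkV2 hkV2' hbA
    obtain ⟨ε, _, hLl⟩ := LInv.levels_spec hlp hLA hA0 hbL (lp.l - k₀) (by omega)
    rw [show k₀ + (lp.l - k₀) = lp.l by omega] at hLl
    set sL := levels lp k₀ (lp.l - k₀) (gwalk lp.pm (pref lp.T lp.l k₀ - lp.c₀) lp.N (s0 lp.pm)) with hsL
    -- the window at the top level: `1 < |θ| < ε₀`, and `ε₀ ≤ 2^{6n+12} |θ|`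
    have eΔ : lp.pm = pm := rfl
    have hgood : Good pm sL ε := by have := hLl.good; rw [eΔ] at this; exact this
    have hlo := hLl.lo
    have hhi := hLl.hi
    rw [hlT, pref_self, eΔ, hΔ] at hlo hhi
    have hnrt : Real.logb 2 (rt (disc d)) < n := hlp.n_rt
    have hθpos : 0 < |ev (disc d) (rt (disc d)) sL.fr.p| := abs_pos.mpr (hgood.inv.ev_p_ne_zero hpm.disc)
    set Lθ := Real.logb 2 |ev (disc d) (rt (disc d)) sL.fr.p| with hLθ
    have hc₀R : ((lp.c₀ : ℕ) : ℝ) = 2 * n + 8 := by rw [hc₀]; push_cast; ring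
    rw [hc₀R] at hlo hhi
    have hn1 : (1 : ℝ) ≤ n := by exact_mod_cast (show 1 ≤ n by omega)
    have hLθpos : 0 < Lθ := by linarith [hlo, hr2.1, hr2.2]
    have hLθlt : Lθ < L := by linarith [hhi, hr2.1]
    have h1 : 1 < |ev (disc d) (rt (disc d)) sL.fr.p| := (Real.logb_pos_iff (by norm_num) hθpos).mp hLθpos
    have hlt : |ev (disc d) (rt (disc d)) sL.fr.p| < ev (disc d) (rt (disc d)) u₀ :=
      (Real.logb_lt_logb_iff (by norm_num) hθpos hε0).mp hLθlt
    have hk : ev (disc d) (rt (disc d)) u₀ ≤ (2 : ℝ) ^ (6 * n + 12) * |ev (disc d) (rt (disc d)) sL.fr.p| := by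
      rw [← Real.logb_le_logb (b := 2) (by norm_num) hε0 (by positivity), Real.logb_mul (by positivity) hθpos.ne',
        Real.logb_pow, Real.logb_self_eq_one (by norm_num)]
      push_cast
      linarith [hlo, hr2.2]
    have hp := large_final hpm hu hε0 hleast hgood h1 hlt hk (N := N) (by omega)
    exact out_eq hX hY hp

end Literature.Computability.Cryptography.UnitResidue

end
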